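import Literature.Probability.RandomPlanarGeometry.SAWTubeCount
import Literature.Probability.RandomPlanarGeometry.SAWWords
import Literature.Probability.RandomPlanarGeometry.SAWReflect
import Mathlib.NumberTheory.Real.GoldenRatio
import Mathlib.Analysis.SpecificLimits.Normed
import HarnessLib

/-!
# The connective constant of the ladder `ℤ × {0,1}` is the golden mean `(1+√5)/2`

Topic `Literature/Probability/RandomPlanarGeometry` (continues `SAWTubeCount.lean`: the tubes/slabs
`R[k,T] = ℤ^k × {0,…,T}^{d-k}` of Madras–Slade §8.2, `Zd.tubeCount d k T N = c_N(R[k,T])`,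
`Zd.tubeConnectiveConstant d k T = μ(R[k,T]) = inf_N c_N(R)^{1/N}`; and `SAWWords.lean`: step words).

## The printed statement

G. R. Grimmett, Z. Li, *Bounds on connective constants of regular graphs*, Combinatorica **35**
(2015) 279–294 = arXiv:1210.6277, §1 (held text `paper:arxiv-1210.6277` p0005:L48–L59): "The
connective constant is known exactly for a limited class of quasi-transitive graphs, of which we
mention the ladder 𝕃, the hexagonal lattice ℍ, and the [bridge graph] 𝕃𝔾_Δ with degree Δ ≥ 2 …,
for which `μ(𝕃) = ½(√5 + 1)`, `μ(ℍ) = √(2+√2)`, `μ(𝕃𝔾_Δ) = √(Δ−1)`. See [AJ90] and [ds] for the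
first two calculations." Here [AJ90] = S. E. Alm, S. Janson, *Random self-avoiding walks on
one-dimensional lattices*, Commun. Statist. Stochastic Models **6** (1990) 169–212 (the primary
source; the strip constants `μ(ℤ × {0,…,n})`, `n ≤ 8`, are tabulated there, `μ(ℤ × {0,1}) =
1.618034`, cf. Lindorfer, *The Language of Self-Avoiding Walks* (2018) Table 2.1); also
Grimmett–Li, *Strict inequalities for connective constants of transitive graphs*, SIAM J. Discrete
Math. **28** (2014) = arXiv:1301.3091 p0008:L61–L62: "the ladder graph … whose connective constant is
the golden mean `φ := ½(√5+1)`".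

The ladder `𝕃 = ℤ × {0,1}` is Madras–Slade's tube `R[1,1] ⊂ ℤ²` (`d = 2`, `k = 1`, `T = 1`), so the
statement is typed over the tree's `Zd.tubeConnectiveConstant 2 1 1` (walks counted up to horizontal
translation, from both starting heights — the same exponential growth rate):

* `Ladder.tubeConnectiveConstant_ladder : Zd.tubeConnectiveConstant 2 1 1 = φ` (`Real.goldenRatio`),
* `Ladder.tubeConnectiveConstant_ladder_eq : Zd.tubeConnectiveConstant 2 1 1 = (1 + √5)/2`,

with the two quantitative halves `Ladder.goldenRatio_pow_le_tubeCount : φ^N ≤ c_N(R[1,1])` and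
`Ladder.tubeCount_ladder_le : c_N(R[1,1]) ≤ 12 (N+1)² φ^N` (all `N`).

Grimmett–Li's own definition (§2, (2.1): `μ(G) := lim_n sup_v σ_n(v)^{1/n}`, `σ_n(v)` = number of
`n`-step SAWs from the vertex `v`; `= lim_n σ_n(v)^{1/n}` for quasi-transitive `G`, their Theorem 2)
is served at the end of the file: `Ladder.ladderWalks y₀ N` = the `N`-step SAWs of `𝕃` from `(0,y₀)`
(`y₀ ∈ {0,1}`), `Ladder.card_ladderWalks_one` (both rows give the same count),
`Ladder.tendsto_ladderWalks_rpow : |ladderWalks y₀ N|^{1/N} → (1+√5)/2` and the literal (2.1)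
`Ladder.tendsto_sup_ladderWalks_rpow`, via `½ c_N(R[1,1]) ≤ σ_N ≤ c_N(R[1,1])` (reflection in
`y = ½`, `SAWReflect.lean`) and `Zd.tendsto_tubeCount_rpow`.

## Proof (elementary; not the transfer-matrix proof of [AJ90])

LOWER BOUND. A Boolean word `u` of length `N` with no two consecutive `true`s (there are `F_{N+2} ≥ φ^N`
of them, `Ladder.fw`, `Ladder.goldenRatio_pow_le_card_fw`) encodes the *zigzag* `Ladder.zig u`:
`false ↦` a step `+e₀`, `true ↦` the rung (up from row `0`, down from row `1`). Zigzags are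
self-avoiding walks in the strip (`Ladder.isSAW_zig`, `Ladder.zig_mem_tubePairs`) and the encoding is
injective, so `φ^N ≤ c_N(R[1,1])` and `φ ≤ μ(R[1,1]) = inf_N c_N^{1/N}`.

UPPER BOUND. Read a walk of the strip as its step word `w` (`SAWWords.lean`). Then (i) `w` has no two
consecutive vertical letters (`Ladder.no_VV`), and (ii) — the heart — `w` has AT MOST TWO *turns*,
a turn being a vertical letter whose horizontal neighbours point in opposite directions
(`Ladder.card_turns_le_two`). Indeed (`Ladder.blocked_turn`): if the horizontal run `w[m-r..m-1]`
before a turn at `m` is itself preceded by a vertical letter, then after the turn the walk runs along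
the other row back towards the (visited) site under/over the start of the run, every rung on the way
being blocked by the run: all later letters are horizontal and the word ends within `r - 1` steps. A
second turn is always in this situation (the first turn's vertical letter precedes its run), so it is
terminal, and a third turn is impossible. Consequently `w` is determined by its starting row, its
skeleton (which letters are vertical — a no-`VV` word), the direction of its first horizontal letter,
and its set of `≤ 2` turns (`Ladder.eq_of_code_eq`), whence `c_N(R[1,1]) ≤ 2 · 2φ^N · 3 · (N+1)²`.
Finally `μ(R)^N ≤ c_N(R)` (`Zd.tubeConnectiveConstant_le_rpow`) and `N² (φ/μ)^N → 0` give `μ ≤ φ`.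

(Numerically `c_N(one start)/φ^N → 3.577…`: `1, 3, 6, 12, 20, 36, 58, 100, 160, 268, 430, …`; the
polynomial factor is an artefact of the code. Lane pcv-sawmu, lit-2 gen 5, 2026-08-22.)
-/

noncomputable section

open Finset Filter Topology Literature.Probability.LatticeModels SimpleGraph Real
open scoped BigOperators goldenRatio

namespace Literature.Probability.RandomPlanarGeometry.SAW

/-! ### Step words: one more trajectory lemma and self-avoidance of `s :: w` -/

/-- `traj (s :: w) (i+1) = vec s + traj w i`. [folklore] -/
private theorem traj_cons_succ (s : Step) (w : List Step) (i : ℕ) :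
    traj (s :: w) (i + 1) = Step.vec s + traj w i := by
  simp [traj, List.take_succ_cons]

/-- `s :: w` is self-avoiding iff `w` is and the translate `vec s + traj w` never returns to the
origin. [folklore] -/
private theorem isSAW_cons_iff (s : Step) (w : List Step) :
    IsSAW (s :: w) ↔ IsSAW w ∧ ∀ i ≤ w.length, Step.vec s + traj w i ≠ 0 := by
  constructor
  · intro h
    refine ⟨by simpa using h.drop 1, fun i hi heq => ?_⟩
    have hinj := (isSAW_iff_injOn _).1 h
    have h1 : traj (s :: w) (i + 1) = traj (s :: w) 0 := by
      rw [traj_cons_succ, traj_zero, heq]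
    have := hinj (show i + 1 ∈ {j | j ≤ (s :: w).length} by simp; omega)
      (show 0 ∈ {j | j ≤ (s :: w).length} by simp) h1
    omega
  · rintro ⟨hw, h0⟩
    rw [isSAW_iff_injOn] at hw ⊢
    intro i hi j hj hij
    simp only [Set.mem_setOf_eq, List.length_cons] at hi hj
    rcases i with _ | i <;> rcases j with _ | j
    · rfl
    · exfalso
      rw [traj_zero, traj_cons_succ] at hij
      exact h0 j (by omega) hij.symm
    · exfalso
      rw [traj_zero, traj_cons_succ] at hij
      exact h0 i (by omega) hij
    · rw [traj_cons_succ, traj_cons_succ, add_right_inj] at hij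
      rw [hw (show i ∈ {j | j ≤ w.length} by simp; omega)
        (show j ∈ {j | j ≤ w.length} by simp; omega) hij]

namespace Ladder

/-! ### Fibonacci words: Boolean words with no two consecutive `true`s -/

/-- No two consecutive `true` letters (`true` will encode a vertical step). [folklore] -/
def NoVV : List Bool → Prop
  | [] => True
  | [_] => True
  | a :: b :: t => ¬ (a = true ∧ b = true) ∧ NoVV (b :: t)

/-- The no-`VV` Boolean words of length `n`, generated as `false :: u` / `true :: false :: u`.
[folklore] -/
def fw : ℕ → Finset (List Bool)
  | 0 => {[]}
  | 1 => {[false], [true]}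
  | n + 2 => (fw (n + 1)).image (List.cons false) ∪ (fw n).image (fun u => true :: false :: u)

/-- Members of `fw n` have length `n` and no two consecutive `true`s. [folklore] -/
private theorem mem_fw : ∀ (n : ℕ) {u : List Bool}, u ∈ fw n → u.length = n ∧ NoVV u
  | 0, u, h => by
    simp only [fw, Finset.mem_singleton] at h
    subst h; exact ⟨rfl, trivial⟩
  | 1, u, h => by
    simp only [fw, Finset.mem_insert, Finset.mem_singleton] at h
    rcases h with rfl | rfl <;> exact ⟨rfl, trivial⟩
  | n + 2, u, h => by
    simp only [fw, Finset.mem_union, Finset.mem_image] at h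
    rcases h with ⟨v, hv, rfl⟩ | ⟨v, hv, rfl⟩
    · obtain ⟨hl, hn⟩ := mem_fw (n + 1) hv
      refine ⟨by simp [hl], ?_⟩
      rcases v with _ | ⟨b, t⟩
      · simp at hl
      · exact ⟨by simp, hn⟩
    · obtain ⟨hl, hn⟩ := mem_fw n hv
      refine ⟨by simp [hl], by simp, ?_⟩
      rcases v with _ | ⟨b, t⟩
      · trivial
      · exact ⟨by simp, hn⟩

/-- The Fibonacci recursion `#fw (n+2) = #fw (n+1) + #fw n`. [folklore] -/
private theorem card_fw_add_two (n : ℕ) : (fw (n + 2)).card = (fw (n + 1)).card + (fw n).card := by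
  have h1 : ((fw (n + 1)).image (List.cons false)).card = (fw (n + 1)).card :=
    Finset.card_image_of_injective _ (fun u v h => by simpa using h)
  have h2 : ((fw n).image (fun u => true :: false :: u)).card = (fw n).card :=
    Finset.card_image_of_injective _ (fun u v h => by simpa using h)
  have hdisj : Disjoint ((fw (n + 1)).image (List.cons false))
      ((fw n).image (fun u => true :: false :: u)) := by
    rw [Finset.disjoint_left]
    rintro u hu hu'
    simp only [Finset.mem_image] at hu hu'
    obtain ⟨v, -, rfl⟩ := hu
    obtain ⟨v', -, h⟩ := hu'
    simp at h
  rw [fw, Finset.card_union_of_disjoint hdisj, h1, h2]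

/-- `φ < 2`. [folklore] -/
private theorem goldenRatio_lt_two' : φ < 2 := by
  rw [Real.goldenRatio]
  have : Real.sqrt 5 < 3 := by
    rw [Real.sqrt_lt' (by norm_num)]; norm_num
  linarith

/-- **`φⁿ ≤ #fw n`** (`#fw n = F_{n+2}`), by `φ² = φ + 1`. [folklore] -/
private theorem goldenRatio_pow_le_card_fw : ∀ n : ℕ, φ ^ n ≤ ((fw n).card : ℝ)
  | 0 => by simp [fw]
  | 1 => by
    have : (fw 1).card = 2 := by decide
    rw [this, pow_one]; push_cast; exact goldenRatio_lt_two'.le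
  | n + 2 => by
    rw [card_fw_add_two]
    push_cast
    have h1 := goldenRatio_pow_le_card_fw (n + 1)
    have h0 := goldenRatio_pow_le_card_fw n
    calc φ ^ (n + 2) = φ ^ n * φ ^ 2 := by ring
      _ = φ ^ n * (φ + 1) := by rw [Real.goldenRatio_sq]
      _ = φ ^ (n + 1) + φ ^ n := by ring
      _ ≤ _ := add_le_add h1 h0

/-! ### The zigzag encoding: a no-`VV` word is a self-avoiding walk in the ladder -/

/-- The step word of a zigzag: `false ↦ +e₀` (to the right), `true ↦` the rung, upwards from row `0`
(`r = false`) and downwards from row `1` (`r = true`). [folklore] -/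
def zig : Bool → List Bool → List Step
  | _, [] => []
  | r, false :: u => (0 : Step) :: zig r u
  | r, true :: u => (if r then (3 : Step) else 1) :: zig (!r) u

/-- `zig` preserves length. [folklore] -/
@[simp] private theorem length_zig : ∀ (r : Bool) (u : List Bool), (zig r u).length = u.length
  | _, [] => rfl
  | r, false :: u => by simp [zig, length_zig r u]
  | r, true :: u => by simp [zig, length_zig (!r) u]

/-- `zig r` is injective. [folklore] -/
private theorem zig_injective : ∀ (r : Bool) (u v : List Bool), zig r u = zig r v → u = v
  | _, [], [], _ => rfl
  | r, [], b :: v, h => by cases b <;> simp [zig] at h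
  | r, a :: u, [], h => by cases a <;> simp [zig] at h
  | r, a :: u, b :: v, h => by
    cases a <;> cases b
    · simp only [zig, List.cons.injEq, true_and] at h
      rw [zig_injective r u v h]
    · cases r <;> simp [zig] at h
    · cases r <;> simp [zig] at h
    · simp only [zig, List.cons.injEq] at h
      rw [zig_injective (!r) u v h.2]

/-- The numeric row `0`/`1` of a Boolean row flag. [folklore] -/
private def rowZ (r : Bool) : ℤ := if r then 1 else 0

/-- The `x`-coordinate of a zigzag is never negative. [folklore] -/
private theorem zig_fst_nonneg : ∀ (r : Bool) (u : List Bool) (i : ℕ), 0 ≤ traj (zig r u) i 0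
  | r, [], i => by simp [zig, traj_of_le]
  | r, false :: u, 0 => by simp
  | r, false :: u, i + 1 => by
    rw [zig, traj_cons_succ]
    have := zig_fst_nonneg r u i
    simp [Step.vec, Step.dx] ; omega
  | r, true :: u, 0 => by simp
  | r, true :: u, i + 1 => by
    rw [zig, traj_cons_succ]
    have := zig_fst_nonneg (!r) u i
    cases r <;> simp [Step.vec, Step.dx] at this ⊢ <;> omega

/-- After `i+1` steps of a zigzag starting with a horizontal letter, `x ≥ 1`. [folklore] -/
private theorem zig_fst_pos (r : Bool) (u : List Bool) (i : ℕ) : 1 ≤ traj (zig r (false :: u)) (i + 1) 0 := by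
  rw [zig, traj_cons_succ]
  have := zig_fst_nonneg r u i
  simp [Step.vec, Step.dx]; omega

/-- The `y`-coordinate of a zigzag stays in `{0,1} - rowZ r`. [folklore] -/
private theorem zig_snd_mem : ∀ (r : Bool) (u : List Bool) (i : ℕ),
    traj (zig r u) i 1 + rowZ r = 0 ∨ traj (zig r u) i 1 + rowZ r = 1
  | r, [], i => by cases r <;> simp [zig, traj_of_le, rowZ]
  | r, false :: u, 0 => by cases r <;> simp [rowZ]
  | r, false :: u, i + 1 => by
    rw [zig, traj_cons_succ]
    have := zig_snd_mem r u i
    simpa [Step.vec, Step.dy] using this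
  | r, true :: u, 0 => by cases r <;> simp [rowZ]
  | r, true :: u, i + 1 => by
    rw [zig, traj_cons_succ]
    have := zig_snd_mem (!r) u i
    cases r <;> simp [Step.vec, Step.dy, rowZ] at this ⊢ <;> omega

/-- A zigzag over a no-`VV` word is self-avoiding. [folklore] -/
private theorem isSAW_zig : ∀ (r : Bool) (u : List Bool), NoVV u → IsSAW (zig r u)
  | r, [], _ => by simp [zig, isSAW_nil]
  | r, false :: u, h => by
    have hu : NoVV u := by
      rcases u with _ | ⟨b, t⟩
      · trivial
      · exact h.2
    rw [zig, isSAW_cons_iff]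
    refine ⟨isSAW_zig r u hu, fun i _ heq => ?_⟩
    have h0 := congrFun heq 0
    have := zig_fst_nonneg r u i
    simp [Step.vec, Step.dx] at h0
    omega
  | r, [true], _ => by
    rw [zig, isSAW_cons_iff]
    refine ⟨by simp [zig, isSAW_nil], fun i hi heq => ?_⟩
    simp [zig] at hi; subst hi
    have h1 := congrFun heq 1
    cases r <;> simp [zig, Step.vec, Step.dy] at h1
  | r, true :: b :: t, h => by
    have hb : b = false := by
      cases b
      · rfl
      · exact absurd ⟨rfl, rfl⟩ h.1
    rw [zig, isSAW_cons_iff]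
    refine ⟨isSAW_zig (!r) (b :: t) h.2, fun i hi heq => ?_⟩
    subst hb
    rcases i with _ | i
    · have h1 := congrFun heq 1
      cases r <;> simp [Step.vec, Step.dy] at h1
    · have h0 := congrFun heq 0
      have := zig_fst_pos (!r) t i
      cases r <;> simp [Step.vec, Step.dx] at h0 this <;> omega

/-- **Zigzags are walks in the ladder**: for `u ∈ fw n`, `(0, traj (zig false u)) ∈ S_n(R[1,1])`.
[folklore] -/
private theorem zig_mem_tubePairs {n : ℕ} {u : List Bool} (hu : u ∈ fw n) :
    ((0 : Site 2), traj (zig false u)) ∈ Zd.tubePairs 2 1 1 n := by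
  obtain ⟨hl, hn⟩ := mem_fw n hu
  rw [Zd.mem_tubePairs]
  refine ⟨Zd.zero_mem_tubeStarts 2 1 1, traj_mem_saws (by simp [hl]) (isSAW_zig false u hn),
    fun m _ i hi => ?_⟩
  have hi1 : i = 1 := by
    ext; have := i.isLt; simp only [Fin.val_one]; omega
  subst hi1
  have := zig_snd_mem false u m
  simp only [rowZ, Bool.false_eq_true, ↓reduceIte, add_zero] at this
  simp only [zero_add, Nat.cast_one]
  rcases this with h | h <;> rw [h] <;> norm_num

/-- **Lower bound**: `φⁿ ≤ c_n(R[1,1])` for every `n`. [cite: GrimmettLi2014Bounds, §1 (μ(𝕃) = ½(√5+1))] [cite: AlmJanson1990] -/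
theorem goldenRatio_pow_le_tubeCount (n : ℕ) : φ ^ n ≤ (Zd.tubeCount 2 1 1 n : ℝ) := by
  refine (goldenRatio_pow_le_card_fw n).trans ?_
  rw [Zd.tubeCount]
  exact_mod_cast Finset.card_le_card_of_injOn (fun u => ((0 : Site 2), traj (zig false u)))
    (fun u hu => zig_mem_tubePairs hu) (fun u hu v hv h => by
      have h2 : traj (zig false u) = traj (zig false v) := congrArg Prod.snd h
      have hl : (zig false u).length = (zig false v).length := by
        rw [length_zig, length_zig, (mem_fw n hu).1, (mem_fw n hv).1]
      exact zig_injective false u v (eq_of_traj_eq hl h2))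

/-- **`φ ≤ μ(R[1,1])`**. [cite: GrimmettLi2014Bounds, §1 (μ(𝕃) = ½(√5+1))] [cite: AlmJanson1990] -/
theorem goldenRatio_le_tubeConnectiveConstant : φ ≤ Zd.tubeConnectiveConstant 2 1 1 := by
  refine le_ciInf fun n => ?_
  have h1 : φ = (φ ^ (n + 1)) ^ (1 / ((n : ℝ) + 1)) := by
    rw [one_div, ← Nat.cast_succ, Real.pow_rpow_inv_natCast goldenRatio_pos.le (Nat.succ_ne_zero n)]
  rw [h1]
  exact Real.rpow_le_rpow (by positivity) (goldenRatio_pow_le_tubeCount (n + 1)) (by positivity)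


/-! ### Step bookkeeping -/

/-- Each step is horizontal (`dx = ±1`, `dy = 0`) or vertical (`dx = 0`, `dy = ±1`). [folklore] -/
private theorem step_cases (s : Step) :
    (Step.dx s = 0 ∧ (Step.dy s = 1 ∨ Step.dy s = -1)) ∨
      (Step.dy s = 0 ∧ (Step.dx s = 1 ∨ Step.dx s = -1)) := by
  fin_cases s <;> simp [Step.dx, Step.dy]

/-- A step is determined by `(dx, dy)`. [folklore] -/
private theorem step_eq_of_dx_dy {s s' : Step} (h0 : Step.dx s = Step.dx s') (h1 : Step.dy s = Step.dy s') :
    s = s' := by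
  apply Step.vec_injective
  funext j; fin_cases j <;> simp [h0, h1]

/-- Two sites of `ℤ²` are equal iff both coordinates agree. [folklore] -/
private theorem site_eq {p q : Site 2} (h0 : p 0 = q 0) (h1 : p 1 = q 1) : p = q := by
  funext j; fin_cases j
  · exact h0
  · exact h1

/-- `w.getD i 0 = w[i]` in range. [folklore] -/
private theorem getD_eq_getElem' (w : List Step) {i : ℕ} (hi : i < w.length) : w.getD i 0 = w[i] := by
  simp [List.getD_eq_getElem?_getD, hi]

/-- One step in coordinates: `traj w (i+1) j = traj w i j + vec(w[i]) j`. [folklore] -/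
private theorem traj_succ_apply (w : List Step) {i : ℕ} (hi : i < w.length) (j : Fin 2) :
    traj w (i + 1) j = traj w i j + Step.vec (w.getD i 0) j := by
  rw [traj_succ w hi, getD_eq_getElem' w hi]; rfl

/-- **No immediate reversal** in a self-avoiding word: `vec w[i+1] ≠ -vec w[i]`. [folklore] -/
private theorem no_reversal {w : List Step} (hs : IsSAW w) {i : ℕ} (hi : i + 1 < w.length) :
    ¬ (Step.dx (w.getD (i + 1) 0) = -Step.dx (w.getD i 0) ∧
       Step.dy (w.getD (i + 1) 0) = -Step.dy (w.getD i 0)) := by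
  rintro ⟨h0, h1⟩
  have hinj := (isSAW_iff_injOn w).1 hs
  have key : traj w (i + 2) = traj w i := by
    apply site_eq
    · rw [show i + 2 = (i + 1) + 1 by ring, traj_succ_apply w hi, traj_succ_apply w (by omega)]
      simp only [Step.vec_apply_zero]
      omega
    · rw [show i + 2 = (i + 1) + 1 by ring, traj_succ_apply w hi, traj_succ_apply w (by omega)]
      simp only [Step.vec_apply_one]
      omega
  have := hinj (show i + 2 ∈ {j | j ≤ w.length} by simp; omega)
    (show i ∈ {j | j ≤ w.length} by simp; omega) key
  omega

/-- Consecutive horizontal letters of a self-avoiding word point the same way. [folklore] -/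
private theorem dx_eq_of_consecutive {w : List Step} (hs : IsSAW w) {i : ℕ} (hi : i + 1 < w.length)
    (h0 : Step.dx (w.getD i 0) ≠ 0) (h1 : Step.dx (w.getD (i + 1) 0) ≠ 0) :
    Step.dx (w.getD (i + 1) 0) = Step.dx (w.getD i 0) := by
  have hnr := no_reversal hs hi
  rcases step_cases (w.getD i 0) with ⟨h, -⟩ | ⟨hy, hx⟩
  · exact absurd h h0
  rcases step_cases (w.getD (i + 1) 0) with ⟨h, -⟩ | ⟨hy', hx'⟩
  · exact absurd h h1
  by_contra hne
  apply hnr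
  constructor
  · omega
  · rw [hy, hy']; simp

/-- **Admissible words**: self-avoiding, and the walk started on row `y₀` stays in the strip
`0 ≤ y ≤ 1`. [cite: MadrasSlade1993, §8.2, eq. (8.2.1)] -/
def Adm (y0 : ℤ) (w : List Step) : Prop :=
  IsSAW w ∧ ∀ i ≤ w.length, 0 ≤ y0 + traj w i 1 ∧ y0 + traj w i 1 ≤ 1

/-- **No two consecutive vertical letters** in an admissible word. [folklore] -/
private theorem no_VV {y0 : ℤ} {w : List Step} (hA : Adm y0 w) {i : ℕ} (hi : i + 1 < w.length) :
    ¬ (Step.dx (w.getD i 0) = 0 ∧ Step.dx (w.getD (i + 1) 0) = 0) := by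
  rintro ⟨h0, h1⟩
  obtain ⟨hs, hstrip⟩ := hA
  rcases step_cases (w.getD i 0) with ⟨-, hy⟩ | ⟨-, hx⟩
  swap; · omega
  rcases step_cases (w.getD (i + 1) 0) with ⟨-, hy'⟩ | ⟨-, hx'⟩
  swap; · omega
  have e1 := traj_succ_apply w (show i < w.length by omega) 1
  have e2 := traj_succ_apply w hi 1
  simp only [Step.vec_apply_one] at e1 e2
  have b0 := hstrip i (by omega)
  have b2 := hstrip (i + 1 + 1) (by omega)
  have hsum : Step.dy (w.getD (i + 1) 0) = -Step.dy (w.getD i 0) := by omega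
  exact no_reversal hs hi ⟨by rw [h0, h1]; simp, hsum⟩

/-- **The blocked-turn lemma.** In an admissible word, suppose the letter at `m` is vertical and is
preceded by a horizontal run `w[m-r], …, w[m-1]` (`r ≥ 1`) which is itself preceded by a vertical
letter `w[m-r-1]`, and the letter `w[m+1]` reverses the direction of the run (a *turn*). Then every
later letter is horizontal in the reversed direction, and the word ends within `r - 1` further
steps: the walk is running along the other row towards the visited site below/above the start of
the run. [folklore] -/
private theorem blocked_turn {y0 : ℤ} {w : List Step} (hA : Adm y0 w) {m r : ℕ} (hr : 1 ≤ r)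
    (hrm : r + 1 ≤ m) (hm : m + 1 < w.length)
    (hV : Step.dx (w.getD m 0) = 0)
    (hrun : ∀ s < r, Step.dx (w.getD (m - 1 - s) 0) ≠ 0)
    (hpv : Step.dx (w.getD (m - 1 - r) 0) = 0)
    (hturn : Step.dx (w.getD (m + 1) 0) = -Step.dx (w.getD (m - 1) 0)) :
    (∀ t, m < t → t < w.length → Step.dx (w.getD t 0) = -Step.dx (w.getD (m - 1) 0)) ∧
      w.length ≤ m + r := by
  obtain ⟨hs, hstrip⟩ := id hA
  have hinj := (isSAW_iff_injOn w).1 hs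
  set N := w.length with hN
  set d := Step.dx (w.getD (m - 1) 0) with hd
  -- the run letters all have `dx = d` and `dy = 0`
  have hd0 : d = 1 ∨ d = -1 := by
    rcases step_cases (w.getD (m - 1) 0) with ⟨h, -⟩ | ⟨-, h⟩
    · exact absurd h (hrun 0 hr)
    · exact h
  have runA : ∀ s < r, Step.dx (w.getD (m - 1 - s) 0) = d ∧ Step.dy (w.getD (m - 1 - s) 0) = 0 := by
    intro s
    induction s with
    | zero =>
      intro _
      refine ⟨rfl, ?_⟩
      rcases step_cases (w.getD (m - 1) 0) with ⟨h, -⟩ | ⟨h, -⟩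
      · exact absurd h (hrun 0 hr)
      · exact h
    | succ s ih =>
      intro hs1
      have h1 := ih (by omega)
      have hne := hrun (s + 1) hs1
      have hcons : Step.dx (w.getD (m - 1 - s) 0) = Step.dx (w.getD (m - 1 - (s + 1)) 0) := by
        have := dx_eq_of_consecutive hs (i := m - 1 - (s + 1)) (by omega) hne
          (by rw [show m - 1 - (s + 1) + 1 = m - 1 - s by omega]; exact h1.1 ▸ (by
            rcases hd0 with h | h <;> omega))
        rw [show m - 1 - (s + 1) + 1 = m - 1 - s by omega] at this
        exact this
      refine ⟨by rw [← hcons, h1.1], ?_⟩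
      rcases step_cases (w.getD (m - 1 - (s + 1)) 0) with ⟨h, -⟩ | ⟨h, -⟩
      · exact absurd h hne
      · exact h
  -- positions along the run: `traj w (m - r + s) = (P0 + s d, P1)`
  set P0 := traj w (m - r) 0 with hP0
  set P1 := traj w (m - r) 1 with hP1
  have runP : ∀ s ≤ r, traj w (m - r + s) 0 = P0 + s * d ∧ traj w (m - r + s) 1 = P1 := by
    intro s
    induction s with
    | zero => intro _; simp [hP0, hP1]
    | succ s ih =>
      intro hs1
      have h1 := ih (by omega)
      have hlt : m - r + s < N := by omega
      have e0 := traj_succ_apply w hlt 0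
      have e1 := traj_succ_apply w hlt 1
      have hidx : m - r + s = m - 1 - (r - 1 - s) := by omega
      have hA' := runA (r - 1 - s) (by omega)
      rw [← hidx] at hA'
      simp only [Step.vec_apply_zero, Step.vec_apply_one, hA'.1, hA'.2] at e0 e1
      rw [show m - r + (s + 1) = m - r + s + 1 by omega, e0, e1, h1.1, h1.2]
      constructor
      · push_cast; ring
      · ring
  -- the site before the first vertical and the site after the turn's vertical
  set Q1 := traj w (m - 1 - r) 1 with hQ1
  have hQ0 : traj w (m - 1 - r) 0 = P0 := by
    have e0 := traj_succ_apply w (show m - 1 - r < N by omega) 0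
    rw [show m - 1 - r + 1 = m - r by omega] at e0
    simp only [Step.vec_apply_zero, hpv, add_zero] at e0
    rw [hP0, e0]
  have hQ1' : Q1 = P1 + 1 ∨ Q1 = P1 - 1 := by
    have e1 := traj_succ_apply w (show m - 1 - r < N by omega) 1
    rw [show m - 1 - r + 1 = m - r by omega] at e1
    simp only [Step.vec_apply_one] at e1
    rcases step_cases (w.getD (m - 1 - r) 0) with ⟨-, h | h⟩ | ⟨-, h⟩
    · right; rw [hQ1, hP1, e1, h]; ring
    · left; rw [hQ1, hP1, e1, h]; ring
    · exfalso; omega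
  have hm0 : traj w m 0 = P0 + r * d := by
    have := (runP r le_rfl).1; rwa [show m - r + r = m by omega] at this
  have hm1 : traj w m 1 = P1 := by
    have := (runP r le_rfl).2; rwa [show m - r + r = m by omega] at this
  have hT0 : traj w (m + 1) 0 = P0 + r * d := by
    have e0 := traj_succ_apply w (show m < N by omega) 0
    simp only [Step.vec_apply_zero, hV, add_zero] at e0
    rw [e0, hm0]
  have hT1 : traj w (m + 1) 1 = Q1 := by
    have e1 := traj_succ_apply w (show m < N by omega) 1
    simp only [Step.vec_apply_one] at e1
    have b0 := hstrip (m - 1 - r) (by omega)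
    have b1 := hstrip m (by omega)
    have b2 := hstrip (m + 1) (by omega)
    rw [hm1] at b1
    rw [e1, hm1] at b2 ⊢
    rcases step_cases (w.getD m 0) with ⟨-, h | h⟩ | ⟨-, h⟩
    · rw [h] at b2 ⊢; rcases hQ1' with h' | h' <;> omega
    · rw [h] at b2 ⊢; rcases hQ1' with h' | h' <;> omega
    · exfalso; omega
  -- the main induction after the turn
  have claim : ∀ s, m + 1 + s ≤ N →
      (traj w (m + 1 + s) 0 = P0 + ((r : ℤ) - s) * d ∧ traj w (m + 1 + s) 1 = Q1 ∧ s + 1 ≤ r) ∧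
      (m + 1 + s < N → Step.dx (w.getD (m + 1 + s) 0) = -d) := by
    intro s
    induction s with
    | zero =>
      intro _
      refine ⟨⟨by simp [hT0], by simpa using hT1, by omega⟩, fun _ => by simpa using hturn⟩
    | succ s ih =>
      intro hle
      have hlt : m + 1 + s < N := by omega
      obtain ⟨⟨ih0, ih1, ihr⟩, ihd⟩ := ih hlt.le
      have hdx := ihd hlt
      have hdy : Step.dy (w.getD (m + 1 + s) 0) = 0 := by
        rcases step_cases (w.getD (m + 1 + s) 0) with ⟨h, -⟩ | ⟨h, -⟩
        · exfalso; rw [h] at hdx; rcases hd0 with h' | h' <;> omega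
        · exact h
      have e0 := traj_succ_apply w hlt 0
      have e1 := traj_succ_apply w hlt 1
      simp only [Step.vec_apply_zero, Step.vec_apply_one, hdx, hdy, add_zero] at e0 e1
      have hpos0 : traj w (m + 1 + (s + 1)) 0 = P0 + ((r : ℤ) - (s + 1 : ℕ)) * d := by
        rw [show m + 1 + (s + 1) = m + 1 + s + 1 by omega, e0, ih0]; push_cast; ring
      have hpos1 : traj w (m + 1 + (s + 1)) 1 = Q1 := by
        rw [show m + 1 + (s + 1) = m + 1 + s + 1 by omega, e1, ih1]
      -- the walk cannot reach the column of the first vertical: that site is visited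
      have hsr : s + 1 + 1 ≤ r := by
        by_contra hnot
        have hs1 : s + 1 = r := by omega
        have key : traj w (m + 1 + (s + 1)) = traj w (m - 1 - r) := by
          apply site_eq
          · rw [hpos0, hQ0, hs1]; simp
          · rw [hpos1, hQ1]
        have := hinj (show m + 1 + (s + 1) ∈ {j | j ≤ N} by simp; omega)
          (show m - 1 - r ∈ {j | j ≤ N} by simp; omega) key
        omega
      refine ⟨⟨hpos0, hpos1, hsr⟩, fun hlt' => ?_⟩
      -- the next letter: not vertical (row `P1` is visited along the run), not `+d` (reversal)
      rcases step_cases (w.getD (m + 1 + (s + 1)) 0) with ⟨hv, hvy⟩ | ⟨hh, hhx⟩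
      · exfalso
        have e1' := traj_succ_apply w hlt' 1
        have e0' := traj_succ_apply w hlt' 0
        simp only [Step.vec_apply_zero, Step.vec_apply_one, hv, add_zero] at e0' e1'
        have b := hstrip (m + 1 + (s + 1) + 1) (by omega)
        have bQ := hstrip (m - 1 - r) (by omega)
        have bP := hstrip (m - r) (by omega)
        rw [e1', hpos1] at b
        -- so the new row is `P1`, i.e. the site is the run site `m - r + (r - (s+1) - 1)`… visited
        have hrow : Q1 + Step.dy (w.getD (m + 1 + (s + 1)) 0) = P1 := by
          rw [← hQ1] at bQ; rw [← hP1] at bP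
          rcases hvy with h | h <;> rw [h] at b ⊢ <;> rcases hQ1' with h' | h' <;> omega
        have key : traj w (m + 1 + (s + 1) + 1) = traj w (m - r + (r - (s + 1))) := by
          have hrp := runP (r - (s + 1)) (by omega)
          apply site_eq
          · rw [e0', hpos0, hrp.1]
            have : ((r - (s + 1) : ℕ) : ℤ) = (r : ℤ) - ((s + 1 : ℕ) : ℤ) := by
              rw [Nat.cast_sub (by omega)]
            rw [this]
          · rw [e1', hpos1, hrow, hrp.2]
        have := hinj (show m + 1 + (s + 1) + 1 ∈ {j | j ≤ N} by simp; omega)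
          (show m - r + (r - (s + 1)) ∈ {j | j ≤ N} by simp; omega) key
        omega
      · have hidx : m + 1 + (s + 1) = m + 1 + s + 1 := by omega
        have hlt'' : m + 1 + s + 1 < N := by omega
        rcases hhx with h | h
        · -- `dx = 1`: fine if `d = -1`, reversal if `d = 1`
          rcases hd0 with h' | h'
          · exfalso
            exact no_reversal hs hlt''
              ⟨by rw [← hidx, h, hdx, h']; norm_num, by rw [← hidx, hh, hdy]; simp⟩
          · rw [h, h']; norm_num
        · rcases hd0 with h' | h'
          · rw [h, h']
          · exfalso
            exact no_reversal hs hlt''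
              ⟨by rw [← hidx, h, hdx, h']; norm_num, by rw [← hidx, hh, hdy]; simp⟩
  refine ⟨fun t hmt htN => ?_, ?_⟩
  · obtain ⟨s, rfl⟩ : ∃ s, t = m + 1 + s := ⟨t - m - 1, by omega⟩
    exact (claim s htN.le).2 htN
  · by_contra hlt
    have := (claim (N - m - 1) (by omega)).1.2.2
    omega


/-! ### Turns: at most two per admissible word -/

/-- Letter `m` of `w` is a **turn**: a vertical letter whose two (horizontal) neighbours point in
opposite directions. [folklore] -/
private def IsTurn (w : List Step) (m : ℕ) : Prop :=
  1 ≤ m ∧ m + 1 < w.length ∧ Step.dx (w.getD m 0) = 0 ∧ Step.dx (w.getD (m - 1) 0) ≠ 0 ∧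
    Step.dx (w.getD (m + 1) 0) = -Step.dx (w.getD (m - 1) 0)

/-- Being a turn is decidable. [folklore] -/
private instance (w : List Step) : DecidablePred (IsTurn w) := fun m => by
  unfold IsTurn; infer_instance

/-- The set of turns of `w`. [folklore] -/
private def turns (w : List Step) : Finset ℕ := (Finset.range w.length).filter (IsTurn w)

/-- Membership in `turns`. [folklore] -/
private theorem mem_turns {w : List Step} {m : ℕ} : m ∈ turns w ↔ m < w.length ∧ IsTurn w m := by
  simp [turns]

/-- **A turn preceded by an earlier turn is terminal**: no vertical letter follows it.
[folklore] -/
private theorem dx_ne_zero_after_second_turn {y0 : ℤ} {w : List Step} (hA : Adm y0 w) {m1 m2 : ℕ}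
    (h1 : IsTurn w m1) (h2 : IsTurn w m2) (hlt : m1 < m2) :
    ∀ t, m2 < t → t < w.length → Step.dx (w.getD t 0) ≠ 0 := by
  classical
  obtain ⟨hm1, -, hv1, -, -⟩ := h1
  obtain ⟨-, hm2, hv2, hh2, hturn⟩ := h2
  -- the maximal horizontal run before `m2`, found as the first vertical letter going backwards
  have hex : ∃ s, Step.dx (w.getD (m2 - 1 - s) 0) = 0 :=
    ⟨m2 - 1 - m1, by rwa [show m2 - 1 - (m2 - 1 - m1) = m1 by omega]⟩
  set r := Nat.find hex with hr
  have hpv : Step.dx (w.getD (m2 - 1 - r) 0) = 0 := Nat.find_spec hex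
  have hrun : ∀ s < r, Step.dx (w.getD (m2 - 1 - s) 0) ≠ 0 := fun s hs => Nat.find_min hex hs
  have hr1 : 1 ≤ r := by
    rcases Nat.eq_zero_or_pos r with h | h
    · exfalso; rw [h] at hpv; exact hh2 (by simpa using hpv)
    · exact h
  have hrle : r ≤ m2 - 1 - m1 :=
    Nat.find_le (by rwa [show m2 - 1 - (m2 - 1 - m1) = m1 by omega])
  have hbt := (blocked_turn hA hr1 (by omega) hm2 hv2 hrun hpv hturn).1
  intro t ht htN
  rw [hbt t ht htN]
  rcases step_cases (w.getD (m2 - 1) 0) with ⟨h, -⟩ | ⟨-, h⟩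
  · exact absurd h hh2
  · rcases h with h | h <;> rw [h] <;> norm_num

/-- Three turns in increasing order are impossible. [folklore] -/
private theorem no_three_turns {y0 : ℤ} {w : List Step} (hA : Adm y0 w) {m1 m2 m3 : ℕ}
    (h1 : IsTurn w m1) (h2 : IsTurn w m2) (h3 : IsTurn w m3) (h12 : m1 < m2) (h23 : m2 < m3) :
    False :=
  dx_ne_zero_after_second_turn hA h1 h2 h12 m3 h23 (by have := h3.2.1; omega) h3.2.2.1

/-- **An admissible word has at most two turns.** [folklore] -/
private theorem card_turns_le_two {y0 : ℤ} {w : List Step} (hA : Adm y0 w) : (turns w).card ≤ 2 := by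
  by_contra h
  rw [not_le, Finset.two_lt_card] at h
  obtain ⟨a, ha, b, hb, c, hc, hab, hac, hbc⟩ := h
  rw [mem_turns] at ha hb hc
  rcases Nat.lt_or_gt_of_ne hab with h1 | h1 <;> rcases Nat.lt_or_gt_of_ne hbc with h2 | h2 <;>
    rcases Nat.lt_or_gt_of_ne hac with h3 | h3
  · exact no_three_turns hA ha.2 hb.2 hc.2 h1 h2
  · omega
  · exact no_three_turns hA ha.2 hc.2 hb.2 h3 h2
  · exact no_three_turns hA hc.2 ha.2 hb.2 h3 h1
  · exact no_three_turns hA hb.2 ha.2 hc.2 h1 h3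
  · exact no_three_turns hA hb.2 hc.2 ha.2 h2 h3
  · omega
  · exact no_three_turns hA hc.2 hb.2 ha.2 h2 h1

/-! ### The code of an admissible word: skeleton, first direction, turns -/

/-- The skeleton: which letters are vertical. [folklore] -/
private def skel (w : List Step) : List Bool := w.map (fun s => decide (Step.dx s = 0))

/-- The direction (`dx = ±1`) of the first horizontal letter (`0` if there is none). [folklore] -/
private def d0 : List Step → ℤ
  | [] => 0
  | s :: w => if Step.dx s = 0 then d0 w else Step.dx s

/-- The skeleton has the length of the word. [folklore] -/
@[simp] private theorem length_skel (w : List Step) : (skel w).length = w.length := by simp [skel]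

/-- Letters of the skeleton. [folklore] -/
private theorem getD_skel : ∀ (w : List Step) (i : ℕ),
    (skel w).getD i false = decide (Step.dx (w.getD i 0) = 0)
  | [], i => by simp [skel, Step.dx]
  | s :: w, 0 => by simp [skel]
  | s :: w, i + 1 => by
    simp only [skel, List.map_cons, List.getD_cons_succ]
    exact getD_skel w i

/-- `d0` when the first letter is horizontal. [folklore] -/
private theorem d0_of_first {w : List Step} (hl : 0 < w.length) (h : Step.dx (w.getD 0 0) ≠ 0) :
    d0 w = Step.dx (w.getD 0 0) := by
  rcases w with _ | ⟨s, w⟩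
  · simp at hl
  · simp only [List.getD_cons_zero] at h ⊢
    simp [d0, h]

/-- `d0` when the first letter is vertical and the second horizontal. [folklore] -/
private theorem d0_of_second {w : List Step} (hl : 1 < w.length) (h0 : Step.dx (w.getD 0 0) = 0)
    (h1 : Step.dx (w.getD 1 0) ≠ 0) : d0 w = Step.dx (w.getD 1 0) := by
  rcases w with _ | ⟨s, _ | ⟨s', w⟩⟩
  · simp at hl
  · simp at hl
  · simp only [List.getD_cons_zero, List.getD_cons_succ] at h0 h1 ⊢
    simp [d0, h0, h1]

/-- `d0 ∈ {-1, 0, 1}`. [folklore] -/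
private theorem d0_mem : ∀ w : List Step, d0 w = -1 ∨ d0 w = 0 ∨ d0 w = 1
  | [] => by simp [d0]
  | s :: w => by
    rw [d0]
    split_ifs with h
    · exact d0_mem w
    · rcases step_cases s with ⟨h', -⟩ | ⟨-, h' | h'⟩
      · exact absurd h' h
      · simp [h']
      · simp [h']

/-- Positions of two words agree as long as their letters agree. [folklore] -/
private theorem traj_eq_of_prefix {w w' : List Step} {t : ℕ} (ht : t ≤ w.length) (ht' : t ≤ w'.length)
    (h : ∀ i < t, w.getD i 0 = w'.getD i 0) : traj w t = traj w' t := by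
  induction t with
  | zero => simp
  | succ t ih =>
    apply site_eq <;>
    · rw [traj_succ_apply w (by omega), traj_succ_apply w' (by omega),
        ih (by omega) (by omega) (fun i hi => h i (by omega)), h t (by omega)]

/-- A horizontal step is determined by its `dx`. [folklore] -/
private theorem step_eq_of_dx {s s' : Step} (h : Step.dx s ≠ 0) (h' : Step.dx s = Step.dx s') : s = s' := by
  rcases step_cases s with ⟨hs, -⟩ | ⟨hy, -⟩
  · exact absurd hs h
  rcases step_cases s' with ⟨hs', -⟩ | ⟨hy', -⟩
  · exact absurd (h'.trans hs') h
  exact step_eq_of_dx_dy h' (by rw [hy, hy'])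

/-- In an admissible word, a vertical letter is forced by the current row: `dy = 1 - 2·row`.
[folklore] -/
private theorem dy_eq_of_vertical {y0 : ℤ} {w : List Step} (hA : Adm y0 w) {t : ℕ} (ht : t < w.length)
    (hv : Step.dx (w.getD t 0) = 0) : Step.dy (w.getD t 0) = 1 - 2 * (y0 + traj w t 1) := by
  have b0 := hA.2 t ht.le
  have b1 := hA.2 (t + 1) (by omega)
  have e1 := traj_succ_apply w ht 1
  simp only [Step.vec_apply_one] at e1
  rw [e1] at b1
  rcases step_cases (w.getD t 0) with ⟨-, h | h⟩ | ⟨-, h | h⟩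
  · rw [h] at b1 ⊢; omega
  · rw [h] at b1 ⊢; omega
  · exfalso; rw [hv] at h; omega
  · exfalso; rw [hv] at h; omega

/-- **Injectivity of the code**: two admissible words from the same starting row with the same
skeleton, the same first direction and the same turns are equal. [folklore] -/
private theorem eq_of_code_eq {y0 : ℤ} {w w' : List Step} (hA : Adm y0 w) (hA' : Adm y0 w')
    (hl : w.length = w'.length) (hsk : skel w = skel w') (hd : d0 w = d0 w')
    (ht : turns w = turns w') : w = w' := by
  set N := w.length with hN
  have hv : ∀ i, Step.dx (w.getD i 0) = 0 ↔ Step.dx (w'.getD i 0) = 0 := fun i => by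
    have := getD_skel w i
    rw [hsk, getD_skel] at this
    simpa using this.symm
  have hturn : ∀ m, IsTurn w m ↔ IsTurn w' m := fun m => by
    constructor
    · intro h
      have : m ∈ turns w := mem_turns.2 ⟨by have := h.2.1; omega, h⟩
      rw [ht, mem_turns] at this; exact this.2
    · intro h
      have : m ∈ turns w' := mem_turns.2 ⟨by have := h.2.1; omega, h⟩
      rw [← ht, mem_turns] at this; exact this.2
  -- letters agree, by strong induction on the position
  have key : ∀ t, ∀ i < t, i < N → w.getD i 0 = w'.getD i 0 := by
    intro t
    induction t with
    | zero => intro i hi; omega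
    | succ t ih =>
      intro i hi hiN
      rcases Nat.lt_succ_iff_lt_or_eq.1 hi with hi' | rfl
      · exact ih i hi' hiN
      -- the new letter `i`
      by_cases hvi : Step.dx (w.getD i 0) = 0
      · -- vertical: forced by the common current row
        have hvi' := (hv i).1 hvi
        have hrow : traj w i 1 = traj w' i 1 := by
          rw [traj_eq_of_prefix (le_of_lt hiN) (by omega) (fun j hj => ih j hj (by omega))]
        apply step_eq_of_dx_dy (by rw [hvi, hvi'])
        rw [dy_eq_of_vertical hA hiN hvi, dy_eq_of_vertical hA' (by omega) hvi', hrow]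
      · have hvi' : Step.dx (w'.getD i 0) ≠ 0 := fun h => hvi ((hv i).2 h)
        apply step_eq_of_dx hvi
        rcases Nat.eq_zero_or_pos i with rfl | hipos
        · -- first letter, horizontal: it is the first direction
          rw [← d0_of_first (by omega) hvi, ← d0_of_first (by omega) hvi', hd]
        by_cases hprev : Step.dx (w.getD (i - 1) 0) = 0
        · have hprev' := (hv (i - 1)).1 hprev
          rcases Nat.lt_or_ge i 2 with hi2 | hi2
          · -- `i = 1`, `w[0]` vertical: `w[1]` is the first horizontal letter
            have hi1 : i = 1 := by omega
            subst hi1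
            rw [← d0_of_second (by omega) hprev hvi, ← d0_of_second (by omega) hprev' hvi', hd]
          · -- `w[i-2]` horizontal (no `VV`), equal in both words; turn test at `i-1`
            have hpp : Step.dx (w.getD (i - 2) 0) ≠ 0 := fun h =>
              no_VV hA (i := i - 2) (by omega) ⟨h, by rwa [show i - 2 + 1 = i - 1 by omega]⟩
            have heq2 : w.getD (i - 2) 0 = w'.getD (i - 2) 0 := ih (i - 2) (by omega) (by omega)
            have hx : Step.dx (w.getD i 0) = 1 ∨ Step.dx (w.getD i 0) = -1 := by
              rcases step_cases (w.getD i 0) with ⟨h, -⟩ | ⟨-, h⟩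
              · exact absurd h hvi
              · exact h
            have hx' : Step.dx (w'.getD i 0) = 1 ∨ Step.dx (w'.getD i 0) = -1 := by
              rcases step_cases (w'.getD i 0) with ⟨h, -⟩ | ⟨-, h⟩
              · exact absurd h hvi'
              · exact h
            have hx2 : Step.dx (w.getD (i - 2) 0) = 1 ∨ Step.dx (w.getD (i - 2) 0) = -1 := by
              rcases step_cases (w.getD (i - 2) 0) with ⟨h, -⟩ | ⟨-, h⟩
              · exact absurd h hpp
              · exact h
            by_cases hT : IsTurn w (i - 1)
            · have hT' := (hturn _).1 hT
              have e := hT.2.2.2.2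
              have e' := hT'.2.2.2.2
              rw [show i - 1 + 1 = i by omega, show i - 1 - 1 = i - 2 by omega] at e e'
              rw [e, e', heq2]
            · have hT' : ¬ IsTurn w' (i - 1) := fun h => hT ((hturn _).2 h)
              have e : Step.dx (w.getD i 0) = Step.dx (w.getD (i - 2) 0) := by
                by_contra hne
                apply hT
                refine ⟨by omega, by omega, hprev, by rwa [show i - 1 - 1 = i - 2 by omega], ?_⟩
                rw [show i - 1 + 1 = i by omega, show i - 1 - 1 = i - 2 by omega]
                rcases hx with h | h <;> rcases hx2 with h2 | h2 <;> rw [h, h2] at hne ⊢ <;> omega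
              have e' : Step.dx (w'.getD i 0) = Step.dx (w'.getD (i - 2) 0) := by
                by_contra hne
                apply hT'
                refine ⟨by omega, by omega, hprev', by rw [show i - 1 - 1 = i - 2 by omega, ← heq2]; exact hpp, ?_⟩
                rw [show i - 1 + 1 = i by omega, show i - 1 - 1 = i - 2 by omega]
                rw [← heq2] at hne ⊢
                rcases hx' with h | h <;> rcases hx2 with h2 | h2 <;> rw [h, h2] at hne ⊢ <;> omega
              rw [e, e', heq2]
        · -- previous letter horizontal and equal in both words
          have heq1 : w.getD (i - 1) 0 = w'.getD (i - 1) 0 := ih (i - 1) (by omega) (by omega)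
          have hprev' : Step.dx (w'.getD (i - 1) 0) ≠ 0 := by rw [← heq1]; exact hprev
          have e := dx_eq_of_consecutive hA.1 (i := i - 1) (by omega) hprev
            (by rwa [show i - 1 + 1 = i by omega])
          have e' := dx_eq_of_consecutive hA'.1 (i := i - 1) (by omega) hprev'
            (by rwa [show i - 1 + 1 = i by omega])
          rw [show i - 1 + 1 = i by omega] at e e'
          rw [e, e', heq1]
  refine List.ext_getElem hl fun i hi hi' => ?_
  rw [← getD_eq_getElem' w hi, ← getD_eq_getElem' w' hi']
  exact key (i + 1) i (Nat.lt_succ_self i) hi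


/-! ### Counting the codes -/

/-- Dropping the first letter preserves `NoVV`. [folklore] -/
private theorem NoVV.tail : ∀ {a : Bool} {t : List Bool}, NoVV (a :: t) → NoVV t
  | _, [], _ => trivial
  | _, _ :: _, h => h.2

/-- Every no-`VV` word of length `n` is generated by `fw n`. [folklore] -/
private theorem mem_fw_of_noVV : ∀ (n : ℕ) (u : List Bool), u.length = n → NoVV u → u ∈ fw n
  | 0, [], _, _ => by simp [fw]
  | 0, _ :: _, h, _ => by simp at h
  | 1, [], h, _ => by simp at h
  | 1, [a], _, _ => by cases a <;> simp [fw]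
  | 1, _ :: _ :: _, h, _ => by simp at h
  | n + 2, [], h, _ => by simp at h
  | n + 2, [_], h, _ => by simp at h
  | n + 2, a :: b :: t, hl, hn => by
    simp only [fw, Finset.mem_union, Finset.mem_image]
    cases a
    · left
      exact ⟨b :: t, mem_fw_of_noVV (n + 1) (b :: t) (by simpa using hl) hn.2, rfl⟩
    · right
      have hb : b = false := by
        cases b
        · rfl
        · exact absurd ⟨rfl, rfl⟩ hn.1
      subst hb
      exact ⟨t, mem_fw_of_noVV n t (by simpa using hl) (NoVV.tail hn.2), rfl⟩

/-- `#fw n ≤ 2 φⁿ` (`#fw n = F_{n+2}`). [folklore] -/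
private theorem card_fw_le : ∀ n : ℕ, ((fw n).card : ℝ) ≤ 2 * φ ^ n
  | 0 => by simp [fw]
  | 1 => by
    have : (fw 1).card = 2 := by decide
    rw [this, pow_one]; push_cast; linarith [one_lt_goldenRatio]
  | n + 2 => by
    rw [card_fw_add_two]
    push_cast
    calc (((fw (n + 1)).card : ℝ)) + (fw n).card ≤ 2 * φ ^ (n + 1) + 2 * φ ^ n :=
          add_le_add (card_fw_le (n + 1)) (card_fw_le n)
      _ = 2 * (φ ^ n * (φ + 1)) := by ring
      _ = 2 * (φ ^ n * φ ^ 2) := by rw [Real.goldenRatio_sq]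
      _ = 2 * φ ^ (n + 2) := by ring

/-- A pairwise criterion for `NoVV`. [folklore] -/
private theorem noVV_of_pairs : ∀ u : List Bool,
    (∀ i, i + 1 < u.length → ¬ (u.getD i false = true ∧ u.getD (i + 1) false = true)) → NoVV u
  | [], _ => trivial
  | [_], _ => trivial
  | a :: b :: t, h => by
    refine ⟨fun hab => h 0 (by simp) (by simpa using hab), noVV_of_pairs (b :: t) fun i hi hab => ?_⟩
    exact h (i + 1) (by simp at hi ⊢; omega) (by simpa using hab)

/-- The skeleton of an admissible word is a no-`VV` word. [folklore] -/
private theorem noVV_skel {y0 : ℤ} {w : List Step} (hA : Adm y0 w) : NoVV (skel w) := by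
  refine noVV_of_pairs _ fun i hi hab => ?_
  rw [getD_skel, getD_skel] at hab
  simp only [decide_eq_true_eq] at hab
  exact no_VV hA (by simpa using hi) hab

/-- The skeleton of an admissible word of length `n` lies in `fw n`. [folklore] -/
private theorem skel_mem_fw {y0 : ℤ} {w : List Step} (hA : Adm y0 w) : skel w ∈ fw w.length :=
  mem_fw_of_noVV _ _ (length_skel w) (noVV_skel hA)

/-- The codes for the turn sets: subsets of `{0,…,N-1}` with at most two elements, presented as
images of pairs. [folklore] -/
private def tcode (N : ℕ) : Finset (Finset ℕ) :=
  ((Finset.range (N + 1)) ×ˢ (Finset.range (N + 1))).image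
    (fun p => ({p.1, p.2} : Finset ℕ).filter (· < N))

/-- There are at most `(N+1)²` turn codes. [folklore] -/
private theorem card_tcode_le (N : ℕ) : (tcode N).card ≤ (N + 1) ^ 2 :=
  Finset.card_image_le.trans (by simp [sq])

/-- The turn set of an admissible word is a code. [folklore] -/
private theorem turns_mem_tcode {y0 : ℤ} {w : List Step} (hA : Adm y0 w) : turns w ∈ tcode w.length := by
  set N := w.length with hN
  have hsub : ∀ m ∈ turns w, m < N := fun m hm => (mem_turns.1 hm).1
  have hc := card_turns_le_two hA
  rw [tcode, Finset.mem_image]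
  have h3 : (turns w).card = 0 ∨ (turns w).card = 1 ∨ (turns w).card = 2 := by omega
  rcases h3 with h | h | h
  · rw [Finset.card_eq_zero] at h
    refine ⟨(N, N), by simp, ?_⟩
    rw [h]; ext m; simp; omega
  · obtain ⟨a, ha⟩ := Finset.card_eq_one.1 h
    have haN : a < N := hsub a (by simp [ha])
    refine ⟨(a, a), by simp; omega, ?_⟩
    rw [ha]; ext m; simp; intro hm; omega
  · obtain ⟨a, b, -, hab⟩ := Finset.card_eq_two.1 h
    have haN : a < N := hsub a (by simp [hab])
    have hbN : b < N := hsub b (by simp [hab])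
    refine ⟨(a, b), by simp; omega, ?_⟩
    rw [hab]; ext m; simp; intro hm; rcases hm with rfl | rfl <;> assumption

/-! ### Walks of the ladder as admissible words; the upper bound -/

/-- A pair `(a, υ) ∈ S_N(R[1,1])`: the step word of `υ` is admissible from the row `a 1 ∈ {0,1}`,
has length `N` and trajectory `υ`, and `a 0 = 0`. [cite: MadrasSlade1993, §8.2] -/
private theorem adm_of_mem_tubePairs {N : ℕ} {p : Site 2 × (ℕ → Site 2)} (hp : p ∈ Zd.tubePairs 2 1 1 N) :
    Adm (p.1 1) (wordOf N p.2) ∧ traj (wordOf N p.2) = p.2 ∧ p.1 0 = 0 ∧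
      (p.1 1 = 0 ∨ p.1 1 = 1) := by
  rw [Zd.mem_tubePairs] at hp
  obtain ⟨ha, hυ, hR⟩ := hp
  rw [Zd.mem_tubeStarts] at ha
  have htraj : traj (wordOf N p.2) = p.2 := traj_wordOf hυ
  have ha0 : p.1 0 = 0 := ha.2 0 (by simp)
  have ha1 := ha.1 1 (by simp)
  refine ⟨⟨?_, fun i hi => ?_⟩, htraj, ha0, by omega⟩
  · rw [isSAW_iff_injOn, htraj, length_wordOf]
    exact (Zd.mem_saws.1 hυ).2.2.2
  · rw [length_wordOf] at hi
    have := hR i hi 1 (by simp)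
    rw [htraj]
    simpa using this

/-- **Upper bound**: `c_N(R[1,1]) ≤ 12 (N+1)² φ^N`, by the injective code
`(start row, skeleton, first direction, turns)`. [cite: GrimmettLi2014Bounds, §1 (μ(𝕃) = ½(√5+1))] [cite: AlmJanson1990] -/
theorem tubeCount_ladder_le (N : ℕ) :
    (Zd.tubeCount 2 1 1 N : ℝ) ≤ 12 * ((N : ℝ) + 1) ^ 2 * φ ^ N := by
  classical
  set T : Finset (ℤ × List Bool × ℤ × Finset ℕ) :=
    ({0, 1} : Finset ℤ) ×ˢ (fw N ×ˢ (({-1, 0, 1} : Finset ℤ) ×ˢ tcode N)) with hT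
  have hmain : Zd.tubeCount 2 1 1 N ≤ T.card := by
    rw [Zd.tubeCount]
    refine Finset.card_le_card_of_injOn
      (fun p => (p.1 1, skel (wordOf N p.2), d0 (wordOf N p.2), turns (wordOf N p.2))) ?_ ?_
    · intro p hp
      obtain ⟨hA, -, -, h01⟩ := adm_of_mem_tubePairs hp
      have hl : (wordOf N p.2).length = N := length_wordOf N p.2
      rw [Finset.mem_coe, hT]
      simp only [Finset.mem_product]
      refine ⟨by rcases h01 with h | h <;> simp [h], by simpa [hl] using skel_mem_fw hA, ?_,
        by simpa [hl] using turns_mem_tcode hA⟩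
      rcases d0_mem (wordOf N p.2) with h | h | h <;> simp [h]
    · intro p hp q hq hpq
      obtain ⟨hAp, htp, hp0, -⟩ := adm_of_mem_tubePairs hp
      obtain ⟨hAq, htq, hq0, -⟩ := adm_of_mem_tubePairs hq
      simp only [Prod.mk.injEq] at hpq
      obtain ⟨h1, hsk, hd, ht⟩ := hpq
      have ha : p.1 = q.1 := site_eq (by rw [hp0, hq0]) h1
      rw [ha] at hAp
      have hw : wordOf N p.2 = wordOf N q.2 :=
        eq_of_code_eq hAp hAq (by simp) hsk hd ht
      have hb : p.2 = q.2 := by rw [← htp, ← htq, hw]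
      exact Prod.ext ha hb
  have hcardT : (T.card : ℝ) ≤ 12 * ((N : ℝ) + 1) ^ 2 * φ ^ N := by
    rw [hT, Finset.card_product, Finset.card_product, Finset.card_product]
    have h2 : (({0, 1} : Finset ℤ)).card = 2 := by decide
    have h3 : (({-1, 0, 1} : Finset ℤ)).card = 3 := by decide
    rw [h2, h3]
    have hfw := card_fw_le N
    have htc : ((tcode N).card : ℝ) ≤ ((N : ℝ) + 1) ^ 2 := by exact_mod_cast card_tcode_le N
    push_cast
    have hφ : 0 ≤ φ ^ N := by positivity
    nlinarith [mul_le_mul hfw htc (by positivity) (by positivity)]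
  exact (Nat.cast_le.2 hmain).trans hcardT

/-- **The connective constant of the ladder `ℤ × {0,1}` is the golden mean**:
`μ(R[1,1]) = φ = (1+√5)/2` ("μ(𝕃) = ½(√5+1) … See [AJ90]", Grimmett–Li, Combinatorica 35 §1).
[cite: GrimmettLi2014Bounds, §1 (μ(𝕃) = ½(√5+1))] [cite: AlmJanson1990] -/
theorem tubeConnectiveConstant_ladder : Zd.tubeConnectiveConstant 2 1 1 = φ := by
  refine le_antisymm ?_ goldenRatio_le_tubeConnectiveConstant
  set μ := Zd.tubeConnectiveConstant 2 1 1 with hμ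
  by_contra hlt
  rw [not_le] at hlt
  have hμpos : 0 < μ := goldenRatio_pos.trans hlt
  have hpow : ∀ N : ℕ, N ≠ 0 → μ ^ N ≤ 12 * ((N : ℝ) + 1) ^ 2 * φ ^ N := fun N hN => by
    have h1 := Zd.tubeConnectiveConstant_le_rpow (d := 2) 1 1 hN
    have h2 : μ ^ N ≤ ((Zd.tubeCount 2 1 1 N : ℝ) ^ (1 / (N : ℝ))) ^ N :=
      pow_le_pow_left₀ hμpos.le h1 N
    rw [one_div, Real.rpow_inv_natCast_pow (Nat.cast_nonneg _) hN] at h2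
    exact h2.trans (tubeCount_ladder_le N)
  set r := φ / μ with hr
  have hr0 : 0 < r := div_pos goldenRatio_pos hμpos
  have hr1 : r < 1 := (div_lt_one hμpos).2 hlt
  have hlim := tendsto_pow_const_mul_const_pow_of_abs_lt_one 2 (show |r| < 1 by rwa [abs_of_pos hr0])
  have hev : ∀ᶠ n : ℕ in atTop, (n : ℝ) ^ 2 * r ^ n < 1 / 48 :=
    hlim.eventually (eventually_lt_nhds (by norm_num))
  obtain ⟨N, hN1, hN2⟩ := ((eventually_ge_atTop 1).and hev).exists
  have hkey := hpow N (by omega)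
  have hμN : 0 < μ ^ N := pow_pos hμpos N
  have hrN : r ^ N = φ ^ N / μ ^ N := by rw [hr, div_pow]
  have h1 : (1 : ℝ) ≤ 12 * ((N : ℝ) + 1) ^ 2 * r ^ N := by
    rw [hrN, ← mul_div_assoc, le_div_iff₀ hμN, one_mul]
    exact hkey
  have hN1' : (1 : ℝ) ≤ N := by exact_mod_cast hN1
  have h2 : ((N : ℝ) + 1) ^ 2 ≤ 4 * (N : ℝ) ^ 2 := by nlinarith
  have hrNpos : 0 ≤ r ^ N := pow_nonneg hr0.le N
  nlinarith [mul_le_mul_of_nonneg_right h2 hrNpos]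

/-- The same, with the golden mean written out: `μ(ℤ × {0,1}) = (1 + √5)/2`.
[cite: GrimmettLi2014Bounds, §1 (μ(𝕃) = ½(√5+1))] [cite: AlmJanson1990] -/
theorem tubeConnectiveConstant_ladder_eq :
    Zd.tubeConnectiveConstant 2 1 1 = (1 + Real.sqrt 5) / 2 := by
  rw [tubeConnectiveConstant_ladder, Real.goldenRatio]


/-! ### The printed form (2.1): walks from a vertex of the ladder graph

Grimmett–Li (§2, eq. (2.1), held text p0004:L33–L47) set `σ_n(v)` = the number of `n`-step SAWs from
the vertex `v` and `μ(G) := lim_n (sup_v σ_n(v)^{1/n})`; for a quasi-transitive graph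
`σ_n(v)^{1/n} → μ(G)` for every `v` (their Theorem 2 = Hammersley, p0005:L3–L13). For the ladder,
`σ_N((x, y₀))` is the number of `N`-step self-avoiding walks of `ℤ²` from the origin that stay in the
strip `0 ≤ y₀ + y ≤ 1` (`y₀ ∈ {0,1}` the starting row), independent of `x` and (by the reflection
`y ↦ 1 - y`) of `y₀`; so (2.1) for `𝕃` reads `|ladderWalks y₀ N|^{1/N} → ½(1+√5)`. -/

open Classical in
/-- The `N`-step self-avoiding walks of `ℤ²` from `0` staying in the strip `-y₀ ≤ y ≤ 1 - y₀`: the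
`N`-step SAWs of the ladder `ℤ × {0,1}` from the vertex `(0, y₀)`, translated to the origin
(`σ_N(v)` of Grimmett–Li (2.1) for `v = (0, y₀)`). [cite: GrimmettLi2014Bounds, §1 (μ(𝕃) = ½(√5+1))] -/
def ladderWalks (y0 : ℤ) (N : ℕ) : Finset (ℕ → Site 2) :=
  (Zd.saws 2 N).filter (fun υ => ∀ m ≤ N, 0 ≤ y0 + υ m 1 ∧ y0 + υ m 1 ≤ 1)

/-- Membership in `ladderWalks`. [folklore] -/
private theorem mem_ladderWalks {y0 : ℤ} {N : ℕ} {υ : ℕ → Site 2} :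
    υ ∈ ladderWalks y0 N ↔ υ ∈ Zd.saws 2 N ∧ ∀ m ≤ N, 0 ≤ y0 + υ m 1 ∧ y0 + υ m 1 ≤ 1 := by
  classical
  rw [ladderWalks, Finset.mem_filter]

/-- The starting sites of `S_N(R[1,1])` are `(0,0)` and `(0,1)`: `a 0 = 0`, `a 1 ∈ {0,1}`.
[cite: MadrasSlade1993, §8.2, eq. (8.2.1)] -/
private theorem tubeStarts_two (a : Site 2) :
    a ∈ Zd.tubeStarts 2 1 1 ↔ a 0 = 0 ∧ (a 1 = 0 ∨ a 1 = 1) := by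
  rw [Zd.mem_tubeStarts]
  constructor
  · rintro ⟨h1, h0⟩
    have := h1 1 (by simp)
    refine ⟨h0 0 (by simp), by push_cast at this; omega⟩
  · rintro ⟨h0, h1⟩
    refine ⟨fun i hi => ?_, fun i hi => ?_⟩
    · have : i = 1 := by ext; have := i.isLt; simp only [Fin.val_one]; omega
      subst this; push_cast; omega
    · have : i = 0 := by ext; simp only [Fin.val_zero]; omega
      subst this; exact h0

/-- Reflection `y ↦ -y` of a vertex function. [folklore] -/
private def reflY (υ : ℕ → Site 2) : ℕ → Site 2 := fun m => Zd.reflAt 1 0 (υ m)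

/-- `reflY` preserves `saws`. [folklore] -/
private theorem reflY_mem_saws {N : ℕ} {υ : ℕ → Site 2} (h : υ ∈ Zd.saws 2 N) :
    reflY υ ∈ Zd.saws 2 N := by
  obtain ⟨h0, hend, hadj, hinj⟩ := Zd.mem_saws.1 h
  refine Zd.mem_saws.2 ⟨?_, fun i hi => ?_, fun i hi => ?_, fun i hi j hj hij => ?_⟩
  · simp only [reflY, h0]; funext j; by_cases hj : j = 1
    · subst hj; simp
    · simp [hj]
  · simp only [reflY, hend i hi]
  · exact (Zd.zdGraph_adj_reflAt 1 0 _ _).2 (hadj i hi)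
  · exact hinj hi hj (Zd.reflAt_injective 1 0 hij)

/-- `reflY` is injective. [folklore] -/
private theorem reflY_injective : Function.Injective reflY := fun υ υ' h => by
  funext m; exact Zd.reflAt_injective 1 0 (congrFun h m)

/-- `σ_N((0,y₀)) ≤ c_N(R[1,1])`. [folklore] -/
private theorem card_ladderWalks_le {y0 : ℤ} (hy : y0 = 0 ∨ y0 = 1) (N : ℕ) :
    (ladderWalks y0 N).card ≤ Zd.tubeCount 2 1 1 N := by
  rw [Zd.tubeCount]
  refine Finset.card_le_card_of_injOn (fun υ => ((fun j => if j = 1 then y0 else 0 : Site 2), υ))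
    (fun υ hυ => ?_) (fun υ _ υ' _ h => congrArg Prod.snd h)
  rw [Finset.mem_coe, mem_ladderWalks] at hυ
  rw [Finset.mem_coe, Zd.mem_tubePairs]
  refine ⟨(tubeStarts_two _).2 ⟨by simp, by simpa using hy⟩, hυ.1, fun m hm i hi => ?_⟩
  have : i = 1 := by ext; have := i.isLt; simp only [Fin.val_one]; omega
  subst this
  simpa using hυ.2 m hm

/-- `c_N(R[1,1]) ≤ 2 σ_N((0,y₀))`: a walk from the other row is reflected. [folklore] -/
private theorem tubeCount_le_two_mul {y0 : ℤ} (hy : y0 = 0 ∨ y0 = 1) (N : ℕ) :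
    Zd.tubeCount 2 1 1 N ≤ 2 * (ladderWalks y0 N).card := by
  classical
  have h2 : (({0, 1} : Finset ℤ)).card = 2 := by decide
  have hprod : (ladderWalks y0 N ×ˢ ({0, 1} : Finset ℤ)).card = (ladderWalks y0 N).card * 2 := by
    rw [Finset.card_product, h2]
  rw [Zd.tubeCount, mul_comm, ← hprod]
  refine Finset.card_le_card_of_injOn
    (fun p => (if p.1 1 = y0 then p.2 else reflY p.2, p.1 1)) (fun p hp => ?_) ?_
  · rw [Finset.mem_coe, Zd.mem_tubePairs] at hp
    obtain ⟨ha, hυ, hR⟩ := hp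
    obtain ⟨ha0, ha1⟩ := (tubeStarts_two _).1 ha
    have hstrip : ∀ m ≤ N, 0 ≤ p.1 1 + p.2 m 1 ∧ p.1 1 + p.2 m 1 ≤ 1 := fun m hm => by
      simpa using hR m hm 1 (by simp)
    rw [Finset.mem_coe, Finset.mem_product]
    refine ⟨?_, by rcases ha1 with h | h <;> simp [h]⟩
    show (if p.1 1 = y0 then p.2 else reflY p.2) ∈ ladderWalks y0 N
    split_ifs with hy'
    · exact mem_ladderWalks.2 ⟨hυ, fun m hm => by rw [← hy']; exact hstrip m hm⟩
    · refine mem_ladderWalks.2 ⟨reflY_mem_saws hυ, fun m hm => ?_⟩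
      have hb := hstrip m hm
      have hr : reflY p.2 m 1 = -(p.2 m 1) := by simp [reflY]
      rw [hr]
      rcases hy with rfl | rfl <;> rcases ha1 with h | h <;> rw [h] at hy' hb <;> omega
  · intro p hp q hq hpq
    simp only [Prod.mk.injEq] at hpq
    obtain ⟨hw, h1⟩ := hpq
    rw [Finset.mem_coe, Zd.mem_tubePairs] at hp hq
    have hp0 := ((tubeStarts_two _).1 hp.1).1
    have hq0 := ((tubeStarts_two _).1 hq.1).1
    have ha : p.1 = q.1 := site_eq (by rw [hp0, hq0]) h1
    refine Prod.ext ha ?_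
    rw [h1] at hw
    split_ifs at hw with hc
    · exact hw
    · exact reflY_injective hw

/-- Reflection in the line `y = ½` maps the walks from row `y₀` into those from row `1 - y₀`.
[folklore] -/
private theorem card_ladderWalks_le_refl {y0 y1 : ℤ} (h : y0 + y1 = 1) (N : ℕ) :
    (ladderWalks y0 N).card ≤ (ladderWalks y1 N).card := by
  classical
  refine Finset.card_le_card_of_injOn reflY (fun υ hυ => ?_) (fun υ _ υ' _ h => reflY_injective h)
  rw [Finset.mem_coe, mem_ladderWalks] at hυ ⊢
  refine ⟨reflY_mem_saws hυ.1, fun m hm => ?_⟩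
  have hb := hυ.2 m hm
  have hr : reflY υ m 1 = -(υ m 1) := by simp [reflY]
  rw [hr]
  omega

/-- `σ_N(v)` does not depend on the vertex `v` of the ladder: both rows give the same count (the
ladder is vertex-transitive). [cite: GrimmettLi2014Bounds, §1–§2 (𝕃 transitive; (2.1))] -/
theorem card_ladderWalks_one (N : ℕ) : (ladderWalks 1 N).card = (ladderWalks 0 N).card :=
  le_antisymm (card_ladderWalks_le_refl (by norm_num) N) (card_ladderWalks_le_refl (by norm_num) N)

/-- `c_N(R[1,1])^{1/N} → φ`. [cite: GrimmettLi2014Bounds, §1 (μ(𝕃) = ½(√5+1))] [cite: AlmJanson1990] -/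
theorem tendsto_tubeCount_ladder_rpow :
    Tendsto (fun N : ℕ => (Zd.tubeCount 2 1 1 N : ℝ) ^ (1 / (N : ℝ))) atTop (𝓝 φ) := by
  rw [← tubeConnectiveConstant_ladder]
  exact Zd.tendsto_tubeCount_rpow (d := 2) le_rfl 1

/-- **Grimmett–Li's form (2.1) of `μ(𝕃) = φ`**: for each vertex `v = (0, y₀)` of the ladder
(`y₀ ∈ {0,1}`; all vertices are equivalent under its automorphisms), `σ_N(v)^{1/N} → (1+√5)/2`, where
`σ_N(v)` counts the `N`-step self-avoiding walks of the ladder from `v`.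
[cite: GrimmettLi2014Bounds, §1 (μ(𝕃) = ½(√5+1), μ defined by (2.1))] [cite: AlmJanson1990] -/
theorem tendsto_ladderWalks_rpow {y0 : ℤ} (hy : y0 = 0 ∨ y0 = 1) :
    Tendsto (fun N : ℕ => ((ladderWalks y0 N).card : ℝ) ^ (1 / (N : ℝ))) atTop
      (𝓝 ((1 + Real.sqrt 5) / 2)) := by
  have hφ : ((1 + Real.sqrt 5) / 2 : ℝ) = φ := rfl
  rw [hφ]
  have hup := tendsto_tubeCount_ladder_rpow
  -- `(1/2)^{1/N} → 1`
  have hhalf : Tendsto (fun N : ℕ => (1 / 2 : ℝ) ^ (1 / (N : ℝ))) atTop (𝓝 1) := by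
    have h1 : Tendsto (fun N : ℕ => Real.log (1 / 2) / (N : ℝ)) atTop (𝓝 0) :=
      tendsto_const_div_atTop_nhds_zero_nat _
    have h2 := (Real.continuous_exp.tendsto _).comp h1
    rw [Real.exp_zero] at h2
    refine h2.congr fun N => ?_
    rw [Function.comp_apply, Real.rpow_def_of_pos (by norm_num), mul_one_div]
  have hlow : Tendsto (fun N : ℕ => (1 / 2 : ℝ) ^ (1 / (N : ℝ)) *
      (Zd.tubeCount 2 1 1 N : ℝ) ^ (1 / (N : ℝ))) atTop (𝓝 φ) := by
    have := hhalf.mul hup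
    rwa [one_mul] at this
  refine tendsto_of_tendsto_of_tendsto_of_le_of_le hlow hup (fun N => ?_) (fun N => ?_)
  · -- `(c_N/2)^{1/N} ≤ σ_N^{1/N}`
    have h := tubeCount_le_two_mul hy N
    have h' : (1 / 2 : ℝ) * (Zd.tubeCount 2 1 1 N : ℝ) ≤ ((ladderWalks y0 N).card : ℝ) := by
      have : (Zd.tubeCount 2 1 1 N : ℝ) ≤ 2 * ((ladderWalks y0 N).card : ℝ) := by exact_mod_cast h
      linarith
    calc (1 / 2 : ℝ) ^ (1 / (N : ℝ)) * (Zd.tubeCount 2 1 1 N : ℝ) ^ (1 / (N : ℝ))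
        = ((1 / 2 : ℝ) * (Zd.tubeCount 2 1 1 N : ℝ)) ^ (1 / (N : ℝ)) :=
          (Real.mul_rpow (by norm_num) (Nat.cast_nonneg _)).symm
      _ ≤ _ := Real.rpow_le_rpow (by positivity) h' (by positivity)
  · exact Real.rpow_le_rpow (Nat.cast_nonneg _) (by exact_mod_cast card_ladderWalks_le hy N)
      (by positivity)

/-- **(2.1) of Grimmett–Li for the ladder, literally**: `μ(𝕃) = lim_N (sup_v σ_N(v)^{1/N}) = ½(1+√5)`,
the `sup` running over the two vertex classes `(·,0)`, `(·,1)` (walk counts are translation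
invariant by construction of `ladderWalks`).
[cite: GrimmettLi2014Bounds, §1 (μ(𝕃) = ½(√5+1)) with §2 (2.1)] [cite: AlmJanson1990] -/
theorem tendsto_sup_ladderWalks_rpow :
    Tendsto (fun N : ℕ => ((max (ladderWalks 0 N).card (ladderWalks 1 N).card : ℕ) : ℝ) ^
      (1 / (N : ℝ))) atTop (𝓝 ((1 + Real.sqrt 5) / 2)) := by
  refine (tendsto_ladderWalks_rpow (y0 := 0) (Or.inl rfl)).congr fun N => ?_
  rw [card_ladderWalks_one, max_self]

end Ladder

end Literature.Probability.RandomPlanarGeometry.SAW
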